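import Mathlib
import Summits.Ventures.PercRepro2.K5Theorem
import Summits.Ventures.PercRepro2.CaseOneCubic
import Summits.Ventures.PercRepro2.TriDisagreementPinned

/-!
# THE TYPED (ii) ON `K₅` IS A KERNEL THEOREM: `CaseOne.TypedII ends5 0 1 2 3 4`
(blind cell PercRepro2, typer-1 g9; the all-marked base of p1's (TRI) architecture, `CaseOneCubic.lean`)

p1's `TypedII` says that every typed three-copy sum of the state kernel `KII` with the free edges
pinned is nonnegative; by `triSum_pinned_eq` such a sum is a nonnegative weight monomial times the
weight-free typed count `typedCount F z τ KII` (`TriDisagreementPinned.lean`).  On `K₅` with the marks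
`(o, a₁, a₂, a₃, b) = (0, 1, 2, 3, 4)` the eight indicators of `KII` are the tables of `K5Kernel.lean`
(`iQ_eq`, …, `iPDoU_eq`, through `K5Conn.lean`), so `KII x y w` is the signed product of tables
(`KII_apply`), and a typed count is the signed triple count of the profile `k` determined by the
minor `(F, z)` and the types `τ` (`typedCount_eq`): `cntPos k − cntNeg k`, which the kernel certificate
`K5.cert_ii` makes nonnegative (`K5Digits.cntNeg_le_cntPos`).  Hence

* **`typedCount_KII_nonneg`**: every weight-free typed count of `KII` on `K₅` is `≥ 0` (all minors, all
  type maps — not only types in `{1, 2}`);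
* **`typedII_K5`**: `CaseOne.TypedII ends5 0 1 2 3 4` — the typed `(ii)` on `K₅`, the base of the (TRI)
  reduction of `(ii)`; `zSplitII_K5'` re-derives `(ii)` on `K₅` through `zSplitII_of_pinned`.
-/

namespace Summit.Ventures.PercRepro2

open Hub

namespace K5

section Indicators

variable {R : Type*} [Field R]

/-- The indicator of a set of configurations is `indR` of any table of the set. -/
lemma indicator_eq_indR (X : Set (Config (Fin 10))) (T : (Fin 10 → Bool) → Bool)
    (hT : ∀ ω, T ω = true ↔ ω ∈ X) : X.indicator (1 : Config (Fin 10) → R) = indR T := by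
  funext ω
  unfold indR
  by_cases h : ω ∈ X
  · rw [Set.indicator_of_mem h, if_pos ((hT ω).2 h)]
    rfl
  · rw [Set.indicator_of_notMem h, if_neg (fun h' => h ((hT ω).1 h'))]

/-- The event of `Dpd` is `PDEvent`. -/
lemma PD_set_eq :
    (connEvent ends5 1 3)ᶜ ∩ (connEvent ends5 2 3)ᶜ ∩ (connEvent ends5 1 2)ᶜ = PDEvent ends5 1 2 3 := by
  unfold PDEvent Dtilde UnionCluster.inU
  ext ω
  simp only [Set.mem_inter_iff, Set.mem_compl_iff, Set.mem_union, mem_connEvent]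
  constructor
  · rintro ⟨⟨h1, h2⟩, h3⟩
    exact ⟨h3, fun h => h.elim (fun h => h1 (conn_symm h)) (fun h => h2 (conn_symm h))⟩
  · rintro ⟨h3, h12⟩
    exact ⟨⟨fun h => h12 (Or.inl (conn_symm h)), fun h => h12 (Or.inr (conn_symm h))⟩, h3⟩

/-- `1_Q` is the table `tQ`. -/
lemma iQ_eq : (CaseOne.iQ ends5 1 2 : Config (Fin 10) → R) = indR tQ := by
  unfold CaseOne.iQ
  rw [CovForm.compl_connEvent_eq_Q]
  exact indicator_eq_indR _ tQ tQ_iff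

/-- `1_A` is the table `tA`. -/
lemma iA_eq : (CaseOne.iA ends5 1 2 3 : Config (Fin 10) → R) = indR tA := by
  unfold CaseOne.iA
  rw [CovForm.compl_connEvent_eq_Q, Set.inter_comm]
  exact indicator_eq_indR _ tA tA_iff

/-- `1_QB` is the table `tQB`. -/
lemma iQB_eq : (CaseOne.iQB ends5 1 2 4 : Config (Fin 10) → R) = indR tQB := by
  unfold CaseOne.iQB
  rw [CovForm.compl_connEvent_eq_Q, Set.inter_comm]
  exact indicator_eq_indR _ tQB tQB_iff

/-- `1_AB` is the table `tAB`. -/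
lemma iAB_eq : (CaseOne.iAB ends5 1 2 3 4 : Config (Fin 10) → R) = indR tAB := by
  unfold CaseOne.iAB
  rw [CovForm.compl_connEvent_eq_Q]
  have : connEvent ends5 2 4 ∩ connEvent ends5 1 3 ∩ avoidAll ends5 2 {1} =
      avoidAll ends5 2 {1} ∩ connEvent ends5 1 3 ∩ connEvent ends5 2 4 := by
    ext ω; simp only [Set.mem_inter_iff]; tauto
  rw [this]
  exact indicator_eq_indR _ tAB tAB_iff

/-- `1_AO` is the table `tAO`. -/
lemma iAO_eq : (CaseOne.iAO ends5 0 1 2 3 : Config (Fin 10) → R) = indR tAO := by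
  unfold CaseOne.iAO
  rw [CovForm.compl_connEvent_eq_Q]
  have : connEvent ends5 1 3 ∩ connEvent ends5 2 0 ∩ avoidAll ends5 2 {1} =
      avoidAll ends5 2 {1} ∩ connEvent ends5 1 3 ∩ connEvent ends5 2 0 := by
    ext ω; simp only [Set.mem_inter_iff]; tauto
  rw [this]
  exact indicator_eq_indR _ tAO tAO_iff

/-- `1_ABO` is the table `tABO`. -/
lemma iABO_eq : (CaseOne.iABO ends5 0 1 2 3 4 : Config (Fin 10) → R) = indR tABO := by
  unfold CaseOne.iABO
  rw [CovForm.compl_connEvent_eq_Q]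
  have : connEvent ends5 2 4 ∩ connEvent ends5 1 3 ∩ connEvent ends5 2 0 ∩ avoidAll ends5 2 {1} =
      avoidAll ends5 2 {1} ∩ connEvent ends5 1 3 ∩ connEvent ends5 2 4 ∩ connEvent ends5 2 0 := by
    ext ω; simp only [Set.mem_inter_iff]; tauto
  rw [this]
  exact indicator_eq_indR _ tABO tABO_iff

/-- `1_PD` is the table `tPD`. -/
lemma iPDc_eq : (CaseOne.iPDc ends5 1 2 3 : Config (Fin 10) → R) = indR tPD := by
  unfold CaseOne.iPDc
  rw [PD_set_eq]
  exact indicator_eq_indR _ tPD tPD_iff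

/-- `1_PDoU` is the table `tPDoU`. -/
lemma iPDoU_eq : (CaseOne.iPDoU ends5 0 1 2 3 : Config (Fin 10) → R) = indR tPDoU := by
  unfold CaseOne.iPDoU
  have : (connEvent ends5 1 0 ∪ connEvent ends5 2 0) ∩ (connEvent ends5 1 3)ᶜ ∩
      (connEvent ends5 2 3)ᶜ ∩ (connEvent ends5 1 2)ᶜ =
      PDEvent ends5 1 2 3 ∩ (connEvent ends5 1 0 ∪ connEvent ends5 2 0) := by
    rw [← PD_set_eq]; ext ω; simp only [Set.mem_inter_iff, Set.mem_union, Set.mem_compl_iff]; tauto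
  rw [this]
  exact indicator_eq_indR _ tPDoU tPDoU_iff

/-- **The state kernel on `K₅` is the signed product of the eight tables.** -/
lemma KII_apply (x y w : Config (Fin 10)) :
    CaseOne.KII (R := R) ends5 0 1 2 3 4 x y w =
      indR tABO x * indR tQ y * indR tPD w + indR tQB x * indR tPDoU y * indR tA w -
        indR tQB x * indR tAO y * indR tPD w - indR tAB x * indR tPDoU y * indR tQ w := by
  unfold CaseOne.KII CovForm.sepKernel
  simp only [Fin.sum_univ_succ, Fin.sum_univ_zero, Matrix.cons_val_zero, Matrix.cons_val_succ,
    add_zero]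
  rw [iABO_eq, iQ_eq, iPDc_eq, iQB_eq, iPDoU_eq, iA_eq, iAO_eq, iAB_eq]
  ring

end Indicators

section TypedCount

variable {R : Type*} [Field R] [LinearOrder R] [IsStrictOrderedRing R]

/-- The profile of a minor `(F, z)` with types `τ ≤ 3` on `F`: `τ` on `F`, `3 · z` off `F`. -/
lemma exists_profile (F : Finset (Fin 10)) (z : Config (Fin 10)) (τ : Fin 10 → ℕ)
    (hτ : ∀ e ∈ F, τ e ≤ 3) :
    ∃ k : Fin 10 → Fin 4, ∀ e, (k e : ℕ) = if e ∈ F then τ e else if z e then 3 else 0 := by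
  refine ⟨fun e => if he : e ∈ F then ⟨τ e, Nat.lt_succ_of_le (hτ e he)⟩ else if z e then 3 else 0,
    fun e => ?_⟩
  by_cases he : e ∈ F
  · simp [he]
  · simp only [dif_neg he, if_neg he]
    cases z e <;> rfl

omit [LinearOrder R] [IsStrictOrderedRing R] in
/-- The constraint of a typed count is the profile constraint `prof x y w = k`. -/
lemma typed_constraint_iff (F : Finset (Fin 10)) (z : Config (Fin 10)) (τ : Fin 10 → ℕ)
    (k : Fin 10 → Fin 4) (hk : ∀ e, (k e : ℕ) = if e ∈ F then τ e else if z e then 3 else 0)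
    (x y w : Config (Fin 10)) :
    ((∀ e, e ∉ F → x e = z e ∧ y e = z e ∧ w e = z e) ∧ (∀ e ∈ F, openCount x y w e = τ e)) ↔
      prof x y w = k := by
  constructor
  · rintro ⟨h1, h2⟩
    funext e
    apply Fin.ext
    rw [hk e]
    by_cases he : e ∈ F
    · rw [if_pos he]
      exact h2 e he
    · rw [if_neg he]
      obtain ⟨hx, hy, hw⟩ := h1 e he
      simp only [Hub.prof, hx, hy, hw]
      cases z e <;> rfl
  · intro hprof
    constructor
    · intro e he
      have := congrArg (fun f => (f e : ℕ)) hprof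
      simp only [Hub.prof] at this
      rw [hk e, if_neg he] at this
      revert this
      cases z e <;> cases x e <;> cases y e <;> cases w e <;> intro this <;> simp at this ⊢
    · intro e he
      have := congrArg (fun f => (f e : ℕ)) hprof
      simp only [Hub.prof] at this
      rw [hk e, if_pos he] at this
      exact this

omit [LinearOrder R] [IsStrictOrderedRing R] in
/-- **A typed count of `KII` on `K₅` is the signed triple count of its profile.** -/
lemma typedCount_eq (F : Finset (Fin 10)) (z : Config (Fin 10)) (τ : Fin 10 → ℕ)
    (k : Fin 10 → Fin 4) (hk : ∀ e, (k e : ℕ) = if e ∈ F then τ e else if z e then 3 else 0) :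
    typedCount F z τ (CaseOne.KII (R := R) ends5 0 1 2 3 4) =
      ((cntPos k : ℕ) : R) - ((cntNeg k : ℕ) : R) := by
  rw [show ((cntPos k : ℕ) : R) - ((cntNeg k : ℕ) : R) =
      coef3 (indR tABO) (indR tQ) (indR tPD) k + coef3 (indR tQB) (indR tPDoU) (indR tA) k -
        coef3 (indR tQB) (indR tAO) (indR tPD) k - coef3 (indR tAB) (indR tPDoU) (indR tQ) k by
    rw [coef3_eq_cnt3, coef3_eq_cnt3, coef3_eq_cnt3, coef3_eq_cnt3]
    unfold cntPos cntNeg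
    push_cast
    ring]
  unfold typedCount coef3
  simp only [typed_constraint_iff F z τ k hk, KII_apply, Finset.sum_filter, Fintype.sum_prod_type]
  rw [← Finset.sum_add_distrib, ← Finset.sum_sub_distrib, ← Finset.sum_sub_distrib]
  refine Finset.sum_congr rfl fun x _ => ?_
  rw [← Finset.sum_add_distrib, ← Finset.sum_sub_distrib, ← Finset.sum_sub_distrib]
  refine Finset.sum_congr rfl fun y _ => ?_
  rw [← Finset.sum_add_distrib, ← Finset.sum_sub_distrib, ← Finset.sum_sub_distrib]
  refine Finset.sum_congr rfl fun w _ => ?_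
  by_cases h : prof x y w = k <;> simp [h]

/-- **Every weight-free typed count of the state kernel on `K₅` is nonnegative** — all minors `(F, z)`,
all type maps (the kernel certificate `K5.cert_ii`). -/
theorem typedCount_KII_nonneg (F : Finset (Fin 10)) (z : Config (Fin 10)) (τ : Fin 10 → ℕ) :
    0 ≤ typedCount F z τ (CaseOne.KII (R := R) ends5 0 1 2 3 4) := by
  by_cases hτ : ∀ e ∈ F, τ e ≤ 3
  · obtain ⟨k, hk⟩ := exists_profile F z τ hτ
    rw [typedCount_eq F z τ k hk, sub_nonneg]
    exact_mod_cast cntNeg_le_cntPos k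
  · have : typedCount F z τ (CaseOne.KII (R := R) ends5 0 1 2 3 4) = 0 := by
      unfold typedCount
      refine Finset.sum_eq_zero fun x _ => Finset.sum_eq_zero fun y _ =>
        Finset.sum_eq_zero fun w _ => ?_
      rw [if_neg]
      rintro ⟨-, h2⟩
      apply hτ
      intro e he
      rw [← h2 e he]
      unfold openCount
      have := Bool.toNat_le (x e)
      have := Bool.toNat_le (y e)
      have := Bool.toNat_le (w e)
      omega
    rw [this]

/-- **THE TYPED `(ii)` ON `K₅`**: `CaseOne.TypedII ends5 0 1 2 3 4` — every typed three-copy sum of the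
state kernel `KII` with the free edges pinned is nonnegative; the all-marked base of the (TRI)
reduction, in the kernel. -/
theorem typedII_K5 : CaseOne.TypedII (R := R) ends5 0 1 2 3 4 := by
  intro q G σ hq hpin _hσ
  rw [triSum_pinned_eq q G hpin σ]
  exact mul_nonneg (prod_typed_factors_nonneg q hq G σ) (typedCount_KII_nonneg G (pinnedConfig q) σ)

/-- `(ii)` on `K₅` a second time, through the typed base and p1's pinning reduction. -/
theorem zSplitII_K5' (p : Fin 10 → R) (hp : IsProbVec p) : CaseOne.ZSplitII p ends5 0 1 2 3 4 :=
  CaseOne.zSplitII_of_pinned ends5 0 1 2 3 4 typedII_K5 p hp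

end TypedCount

end K5

end Summit.Ventures.PercRepro2
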